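import Literature.NumberTheory.Automorphic.LieAlgebraGLBracket
import Literature.Algebra.Lie.SpecialLinearSimple
import HarnessLib

/-!
# `𝔰𝔩ₙ ⊆ Lie(G)` for every subgroup `G ≤ GL_n(k)` containing `SL_n(k)` (Springer 4.4.10 (3), 2.1.4)

Namespace `Literature.NumberTheory.Automorphic` (the `k`-points vocabulary of `LinearAlgebraicGroups` /
`LieAlgebraGL`: `lieAlgebraGL G ⊆ 𝔤𝔩ₙ` is the Zariski tangent space at `1` of the closure of `G`). THEOREMS
only. For a subgroup `G ≤ GL n k` over an infinite field containing the image of `SL n k`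
(`Matrix.SpecialLinearGroup.toGL`), every traceless matrix lies in `lieAlgebraGL G`:

* `single_mem_lieAlgebraGL_of_specialLinear_le` — the root vectors `E_{ab}` (`a ≠ b`): velocity at `0` of
  the polynomial curve `t ↦ 1 + t E_{ab}` of transvections in `SL_n ≤ G` (`coeffOneMatrix_mem_lieAlgebraGL`,
  Springer 4.1.3/4.4.9);
* `single_sub_single_mem_lieAlgebraGL_of_specialLinear_le` — `E_{aa} − E_{bb} = [E_{ab}, E_{ba}]`
  (`lie_mem_lieAlgebraGL`, Springer 4.4.5 (ii));
* **`mem_lieAlgebraGL_of_trace_eq_zero`** — every `X` with `tr X = 0` (such `X` is a combination of the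
  above, `Literature.Algebra.Lie.SpecialLinearSimple.eq_sum_units_of_trace_eq_zero`).

This is the inclusion `𝔰𝔩ₙ ⊆ Lie(SL_n)` of Springer 4.4.10 (3) / 2.1.4 (the Lie algebra of `SL_n` is `𝔰𝔩ₙ`),
in the form consumed by Goursat-type arguments (`Literature/AlgebraicGeometry/HodgeTheory/GoursatKolchinRibet*`:
the blocks of a monodromy closure containing `SL(Eᵢ)` have Lie algebras containing `𝔰𝔩(Eᵢ)`). The reverse
inclusion `Lie(SL_n) ⊆ 𝔰𝔩ₙ` (`d det = tr`) is not needed there and not proved here.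
Written by the prover seat `hodge-nonav-prover-Ax` (cell `hodge-nonav`).

## References
* [SpringerLAG1998] T. A. Springer, *Linear Algebraic Groups*, 2nd ed. (1998), 2.1.4 (`SL_n`), 4.1.3, 4.4.5 (ii),
  4.4.9, 4.4.10 (3) (`L(GL_n) = 𝔤𝔩ₙ`, `L(SL_n) = 𝔰𝔩ₙ`).
* [Humphreys1972] J. E. Humphreys, *Introduction to Lie Algebras and Representation Theory* (1972), §1.2
  (the basis `E_{ab}`, `H_a` of `𝔰𝔩ₙ`).
-/

noncomputable section

open Polynomial

namespace Literature.NumberTheory.Automorphic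

variable {k : Type*} [Field k] [Infinite k] {n : Type*} [Fintype n] [DecidableEq n]
variable {G : Subgroup (GL n k)}

/-- **Root vectors lie in `Lie(G)` when `SL_n ≤ G`**: for `a ≠ b`, `E_{ab} ∈ lieAlgebraGL G` — the velocity
at `t = 0` of the curve of transvections `t ↦ 1 + t E_{ab}` in `SL_n(k) ≤ G` (Springer 4.4.9: tangent vectors
of polynomial curves through `1`). [cite: SpringerLAG1998, 4.4.9 and 4.4.10 (3)] -/
theorem single_mem_lieAlgebraGL_of_specialLinear_le
    (hG : (Matrix.SpecialLinearGroup.toGL : Matrix.SpecialLinearGroup n k →* GL n k).range ≤ G)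
    {a b : n} (hab : a ≠ b) : Matrix.single a b (1 : k) ∈ lieAlgebraGL G := by
  classical
  -- the curve of transvections
  let γ : k → ↥G := fun t =>
    ⟨Matrix.SpecialLinearGroup.toGL ⟨Matrix.transvection a b t, Matrix.det_transvection_of_ne a b hab t⟩,
      hG ⟨_, rfl⟩⟩
  -- its coordinate polynomials
  let P : GLCoord n → k[X] := Sum.elim
    (fun ij => Polynomial.C (if ij.1 = ij.2 then (1 : k) else 0) + if a = ij.1 ∧ b = ij.2 then Polynomial.X else 0)
    fun _ => 1
  have hP : ∀ (x : k) (c : GLCoord n), glCoordFun ((γ x : ↥G) : GL n k) c = (P c).eval x := by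
    intro x c
    rcases c with ⟨i, j⟩ | u
    · change (Matrix.transvection a b x) i j = _
      simp only [P, Sum.elim_inl, Matrix.transvection, Matrix.add_apply, Matrix.one_apply, Matrix.single_apply,
        Polynomial.eval_add, Polynomial.eval_C]
      split_ifs <;> simp
    · change (Matrix.det (Matrix.transvection a b x))⁻¹ = _
      rw [Matrix.det_transvection_of_ne a b hab, inv_one]
      simp [P]
  have h0 : γ 0 = 1 := by
    refine Subtype.ext (Units.ext ?_)
    change Matrix.transvection a b (0 : k) = 1
    exact Matrix.transvection_zero a b
  have hmem := coeffOneMatrix_mem_lieAlgebraGL γ P hP h0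
  have hA : (Matrix.of fun i j => (P (Sum.inl (i, j))).coeff 1) = Matrix.single a b (1 : k) := by
    ext i j
    simp only [Matrix.of_apply, P, Sum.elim_inl, Polynomial.coeff_add, Polynomial.coeff_C, if_neg one_ne_zero,
      zero_add, Matrix.single_apply]
    split_ifs with h
    · exact Polynomial.coeff_X_one
    · exact Polynomial.coeff_zero 1
  rwa [hA] at hmem

/-- **`E_{aa} − E_{bb} ∈ Lie(G)` when `SL_n ≤ G`** (`a ≠ b`): it is the commutator `[E_{ab}, E_{ba}]` of two
root vectors, and `Lie(G)` is closed under the bracket. [cite: SpringerLAG1998, 4.4.5 (ii) and 4.4.10 (3)] -/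
theorem single_sub_single_mem_lieAlgebraGL_of_specialLinear_le
    (hG : (Matrix.SpecialLinearGroup.toGL : Matrix.SpecialLinearGroup n k →* GL n k).range ≤ G)
    {a b : n} (hab : a ≠ b) : Matrix.single a a (1 : k) - Matrix.single b b 1 ∈ lieAlgebraGL G := by
  have h := lie_mem_lieAlgebraGL (single_mem_lieAlgebraGL_of_specialLinear_le hG hab)
    (single_mem_lieAlgebraGL_of_specialLinear_le hG (Ne.symm hab))
  rwa [Matrix.single_mul_single_same, Matrix.single_mul_single_same, mul_one] at h

/-- **`𝔰𝔩ₙ ⊆ Lie(G)` for `SL_n ≤ G`** (Springer 4.4.10 (3) / 2.1.4: the Lie algebra of `SL_n` is the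
traceless matrices; here the inclusion `⊇` for any subgroup of `GL_n(k)` containing `SL_n(k)`, `k` infinite):
every traceless matrix is a combination of root vectors `E_{ab}` and of `E_{aa} − E_{k₀k₀}`.
[cite: SpringerLAG1998, 4.4.10 (3)] [cite: Humphreys1972, §1.2] -/
theorem mem_lieAlgebraGL_of_trace_eq_zero [Nonempty n]
    (hG : (Matrix.SpecialLinearGroup.toGL : Matrix.SpecialLinearGroup n k →* GL n k).range ≤ G)
    {X : Matrix n n k} (hX : X.trace = 0) : X ∈ lieAlgebraGL G := by
  classical
  obtain ⟨k₀⟩ := ‹Nonempty n›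
  rw [Literature.Algebra.Lie.SpecialLinearSimple.eq_sum_units_of_trace_eq_zero k₀ hX]
  refine Submodule.sum_mem _ fun a _ => Submodule.sum_mem _ fun b _ => Submodule.smul_mem _ _ ?_
  split_ifs with h
  · subst h
    by_cases hak : a = k₀
    · subst hak; rw [sub_self]; exact Submodule.zero_mem _
    · exact single_sub_single_mem_lieAlgebraGL_of_specialLinear_le hG hak
  · exact single_mem_lieAlgebraGL_of_specialLinear_le hG h

end Literature.NumberTheory.Automorphic

end
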